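import Literature.MathematicalPhysics.QuantumFieldTheory.Balaban1983to89.Node00.OpsYOfLetters

/-!
# `Balaban1983to89.B9Thm314WholeReadingCalculus` — READING FUNCTIONALS AND LOCAL POST-MAPS (abstract part of the functional-analytic
# calculus of NODE 00's bond-sector reading): SUBADDITIVE, EVEN, LOCALLY LIPSCHITZ ⇒ «partial sums that approximate on the read set keep
# their bounds»

T. Bałaban, *Propagators for lattice gauge theories in a background field*, Commun. Math. Phys. **99** (1985) 389–434
[`Balaban1985BackgroundPropagators`, "B9"].

statement-level skeleton of published theorems with citation tags; proofs where landed; nothing here is a claim about the Yang–Mills mass gap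

THE PRINTED LOCI (verbatim).  p. 416 (proof of Theorem 3.10): *"From (3.108) it follows that the expansion (3.107) is convergent in all
norms in the inequalities (3.42)–(3.47)"*; p. 427 (proof of Theorem 3.14): *"in the difference they are cancelled … This remark, the
estimates (3.108) and the corresponding estimates for other norms, give the inequalities of the above theorem."*; p. 397 (3.39)–(3.40):
*"|A| = max_μ sup_x |A_μ(x)| … sup_{x≠x′} |x − x′|^{−α}|A(x) − U(Γ_{x,x′})A(x′)U(Γ_{x,x′})⁻¹|"*.

THE POINT.  Print's step from an operator identity O = Σ_ω O_ω (norm-convergent on a finite lattice) to bounds of the (3.42)–(3.46)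
functionals of O by the sums of the same functionals of the terms uses three properties of each functional F of an `𝔸`-valued lattice
function: F(Φ + Ψ) ≤ F(Φ) + F(Ψ), F(−Φ) = F(Φ), and F(Φ) ≤ C·t whenever ‖Φ(x)‖ ≤ t on a finite READ SET S.  THIS FILE is the abstract part
of that calculus (the lattice instances — NODE 00's `supInB`, `l2OfY`, `holderQB`, `cdB`, `cdsB`, `lapB` — are the sibling
`B9Thm314WholeReadingLattice`; the consumer is `B9Thm314WholeCancellation`, rows 22–23 of the N06 certificate):
* `IsReadingFn F S` (zero, subadditive, even, Lipschitz through S) and `IsLocalOp P S S′` (additive, odd, values on S controlled by the argument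
  on S′); `nonneg`, `sub_le`, `le_add_sub`, `sum_le`, `mono`, locality `eq_of_eqOn`; ★ `IsReadingFn.le_of_approx` — if partial sums `P m` obey
  `F (P m) ≤ b` for all m and approximate Φ on S (∀ ε > 0 ∃ m, ‖Φ − P m‖ ≤ ε on S) then `F Φ ≤ b`; closure under finite `⨆`, `max`,
  composition with a local post-map, finite sums of post-maps; `iSup_le_of_partialSums` (the outer sup over the directions E of the product-form
  reading); `bddAbove_range_of_le`.

HONEST SCOPE.  Elementary functional analysis (kernel-checked); nothing of print is asserted; no expansion is constructed; NOT a node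
discharge, NOT summit progress; one finite lattice paper; nothing continuum, nothing about the mass gap.  Cell `pub-ymgap` (D-0062), node N06
[B9], N06-ASSIGNMENT v1 rows 22–23 (successor file of bundle F8), seat `pub-ymgap-dag-n06-m` (g3), 2026-08-27.
-/

noncomputable section

namespace Literature.MathematicalPhysics.QuantumFieldTheory.Balaban1983to89.B9Thm314WholeReadingCalculus

open Finset

/-! ## §1 Reading functionals and local post-maps (abstract) -/

section Abstract

variable {X V : Type} [SeminormedAddCommGroup V]

/-- **A READING FUNCTIONAL ON THE READ SET `S`**: F(0) = 0, F(Φ + Ψ) ≤ F(Φ) + F(Ψ), F(−Φ) = F(Φ), and F(Φ) ≤ C·t whenever ‖Φ(x)‖ ≤ t on S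
(some C ≥ 0) — what every functional of (3.42)–(3.46) is, as a function of the `𝔸`-valued lattice function it reads.
[cite: Balaban1985BackgroundPropagators, (3.39)–(3.40) p.397 + (3.46) p.398 (the functionals), bookkeeping] -/
structure IsReadingFn (F : (X → V) → ℝ) (S : Set X) : Prop where
  zero : F 0 = 0
  add_le : ∀ Φ Ψ : X → V, F (Φ + Ψ) ≤ F Φ + F Ψ
  neg : ∀ Φ : X → V, F (-Φ) = F Φ
  lip : ∃ C : ℝ, 0 ≤ C ∧ ∀ (Φ : X → V) (t : ℝ), 0 ≤ t → (∀ x ∈ S, ‖Φ x‖ ≤ t) → F Φ ≤ C * t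

/-- **A LOCAL POST-MAP**: additive, odd, and its values on `S` are controlled by the argument on `S′` (‖PΦ(x)‖ ≤ C·t on S whenever ‖Φ‖ ≤ t
on S′) — what the covariant differences (3.3), (3.8), (3.23) are. [cite: Balaban1985BackgroundPropagators, (3.3) p.390 + (3.8) p.392 + (3.23) p.395, bookkeeping] -/
structure IsLocalOp (P : (X → V) → (X → V)) (S S' : Set X) : Prop where
  add : ∀ Φ Ψ : X → V, P (Φ + Ψ) = P Φ + P Ψ
  neg : ∀ Φ : X → V, P (-Φ) = -P Φ
  lip : ∃ C : ℝ, 0 ≤ C ∧ ∀ (Φ : X → V) (t : ℝ), 0 ≤ t → (∀ x ∈ S', ‖Φ x‖ ≤ t) → ∀ x ∈ S, ‖P Φ x‖ ≤ C * t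

namespace IsReadingFn

variable {F G : (X → V) → ℝ} {S S' : Set X}

/-- a reading functional is nonnegative. [cite: Balaban1985BackgroundPropagators, (3.39) p.397, bookkeeping] -/
theorem nonneg (h : IsReadingFn F S) (Φ : X → V) : 0 ≤ F Φ := by
  have h1 := h.add_le Φ (-Φ)
  rw [add_neg_cancel, h.zero, h.neg] at h1
  linarith

/-- F(Φ − Ψ) ≤ F(Φ) + F(Ψ). [cite: Balaban1985BackgroundPropagators, (3.39) p.397, bookkeeping] -/
theorem sub_le (h : IsReadingFn F S) (Φ Ψ : X → V) : F (Φ - Ψ) ≤ F Φ + F Ψ := by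
  rw [sub_eq_add_neg]
  exact (h.add_le Φ (-Ψ)).trans (by rw [h.neg])

/-- F(Φ) ≤ F(Ψ) + F(Φ − Ψ). [cite: Balaban1985BackgroundPropagators, (3.39) p.397, bookkeeping] -/
theorem le_add_sub (h : IsReadingFn F S) (Φ Ψ : X → V) : F Φ ≤ F Ψ + F (Φ - Ψ) := by
  have h1 := h.add_le Ψ (Φ - Ψ)
  rwa [add_sub_cancel] at h1

/-- F of a finite sum is at most the sum of the F's. [cite: Balaban1985BackgroundPropagators, Thm 3.10 proof p.416 («convergent in all norms»), bookkeeping] -/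
theorem sum_le {ι : Type} (h : IsReadingFn F S) (s : Finset ι) (g : ι → X → V) :
    F (∑ a ∈ s, g a) ≤ ∑ a ∈ s, F (g a) := by
  classical
  induction s using Finset.induction_on with
  | empty => simp [h.zero]
  | insert a s ha ih =>
    rw [Finset.sum_insert ha, Finset.sum_insert ha]
    exact (h.add_le _ _).trans (add_le_add le_rfl ih)

/-- enlarging the read set. [cite: Balaban1985BackgroundPropagators, (3.39) p.397, bookkeeping] -/
theorem mono (h : IsReadingFn F S) (hS : S ⊆ S') : IsReadingFn F S' := by
  obtain ⟨C, hC, hl⟩ := h.lip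
  exact ⟨h.zero, h.add_le, h.neg, ⟨C, hC, fun Φ t ht hΦ => hl Φ t ht fun x hx => hΦ x (hS hx)⟩⟩

/-- **LOCALITY**: a reading functional only sees its argument on the read set. [cite: Balaban1985BackgroundPropagators, (3.42) p.397 («for x ∈ Δ(y)»), bookkeeping] -/
theorem eq_of_eqOn (h : IsReadingFn F S) {Φ Ψ : X → V} (hΦ : ∀ x ∈ S, Φ x = Ψ x) : F Φ = F Ψ := by
  obtain ⟨C, -, hl⟩ := h.lip
  have key : ∀ Φ Ψ : X → V, (∀ x ∈ S, Φ x = Ψ x) → F Φ ≤ F Ψ := by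
    intro Φ Ψ hΦΨ
    have h0 : F (Φ - Ψ) ≤ C * 0 := hl _ 0 le_rfl fun x hx => by simp [hΦΨ x hx]
    have h1 := h.le_add_sub Φ Ψ
    have h2 := h.nonneg (Φ - Ψ)
    linarith
  exact le_antisymm (key Φ Ψ hΦ) (key Ψ Φ fun x hx => (hΦ x hx).symm)

/-- ★ **PARTIAL SUMS THAT APPROXIMATE ON THE READ SET KEEP THEIR BOUNDS** («limits keep bounds» for a reading functional): if `F (P m) ≤ b` for
every m and, for every ε > 0, some `P m` is ε-close to Φ on S, then `F Φ ≤ b`. [cite: Balaban1985BackgroundPropagators, Thm 3.10 proof p.416 + Thm 3.14 proof p.427] -/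
theorem le_of_approx (h : IsReadingFn F S) {Φ : X → V} {P : ℕ → X → V} {b : ℝ} (hP : ∀ m, F (P m) ≤ b)
    (happrox : ∀ ε : ℝ, 0 < ε → ∃ m, ∀ x ∈ S, ‖Φ x - P m x‖ ≤ ε) : F Φ ≤ b := by
  obtain ⟨C, hC, hl⟩ := h.lip
  refine le_of_forall_pos_le_add fun ε hε => ?_
  obtain ⟨m, hm⟩ := happrox (ε / (C + 1)) (by positivity)
  have hCε : C * (ε / (C + 1)) ≤ ε := by
    rw [mul_div_assoc']
    exact (div_le_iff₀ (by positivity)).2 (by nlinarith)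
  calc F Φ ≤ F (P m) + F (Φ - P m) := h.le_add_sub _ _
    _ ≤ b + C * (ε / (C + 1)) := add_le_add (hP m) (hl _ _ (by positivity) fun x hx => by simpa using hm x hx)
    _ ≤ b + ε := add_le_add le_rfl hCε

/-- a finite supremum of reading functionals is one. [cite: Balaban1985BackgroundPropagators, (3.39) p.397 («max_μ»), bookkeeping] -/
theorem iSup {ι : Type} [Fintype ι] [Nonempty ι] {Fν : ι → (X → V) → ℝ} (h : ∀ ν, IsReadingFn (Fν ν) S) :
    IsReadingFn (fun Φ => ⨆ ν, Fν ν Φ) S where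
  zero := by simp only [(h _).zero, ciSup_const]
  add_le Φ Ψ := by
    refine Real.iSup_le (fun ν => ((h ν).add_le Φ Ψ).trans (add_le_add ?_ ?_))
      (add_nonneg (Real.iSup_nonneg fun ν => (h ν).nonneg Φ) (Real.iSup_nonneg fun ν => (h ν).nonneg Ψ))
    · exact le_ciSup (f := fun ν => Fν ν Φ) (Set.finite_range _).bddAbove ν
    · exact le_ciSup (f := fun ν => Fν ν Ψ) (Set.finite_range _).bddAbove ν
  neg Φ := by simp only [(h _).neg]
  lip := by
    choose C hC hl using fun ν => (h ν).lip
    refine ⟨∑ ν, C ν, Finset.sum_nonneg fun ν _ => hC ν, fun Φ t ht hΦ => Real.iSup_le (fun ν => ?_)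
      (mul_nonneg (Finset.sum_nonneg fun ν _ => hC ν) ht)⟩
    exact (hl ν Φ t ht hΦ).trans (mul_le_mul_of_nonneg_right (Finset.single_le_sum (fun ν _ => hC ν) (Finset.mem_univ ν)) ht)

/-- the maximum of two reading functionals is one. [cite: Balaban1985BackgroundPropagators, (3.43) p.398, bookkeeping] -/
theorem max (hF : IsReadingFn F S) (hG : IsReadingFn G S) : IsReadingFn (fun Φ => max (F Φ) (G Φ)) S where
  zero := by simp only [hF.zero, hG.zero, max_self]
  add_le Φ Ψ := max_le ((hF.add_le Φ Ψ).trans (add_le_add (le_max_left _ _) (le_max_left _ _)))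
    ((hG.add_le Φ Ψ).trans (add_le_add (le_max_right _ _) (le_max_right _ _)))
  neg Φ := by simp only [hF.neg, hG.neg]
  lip := by
    obtain ⟨C, hC, hl⟩ := hF.lip
    obtain ⟨D, hD, hl'⟩ := hG.lip
    exact ⟨C + D, add_nonneg hC hD, fun Φ t ht hΦ => max_le ((hl Φ t ht hΦ).trans (by nlinarith [hl Φ t ht hΦ]))
      ((hl' Φ t ht hΦ).trans (by nlinarith [hl' Φ t ht hΦ]))⟩

/-- a reading functional after a local post-map is a reading functional on the post-map's read set. [cite: Balaban1985BackgroundPropagators, (3.42) p.397 (the entries ∇_UG, Δ_UG), bookkeeping] -/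
theorem comp {P : (X → V) → (X → V)} (hF : IsReadingFn F S) (hP : IsLocalOp P S S') : IsReadingFn (fun Φ => F (P Φ)) S' where
  zero := by
    have h0 : P 0 = 0 := by
      have h1 := hP.add 0 0
      rw [add_zero] at h1
      exact left_eq_add.1 h1
    simp only [h0, hF.zero]
  add_le Φ Ψ := by simp only [hP.add, hF.add_le]
  neg Φ := by simp only [hP.neg, hF.neg]
  lip := by
    obtain ⟨C, hC, hl⟩ := hF.lip
    obtain ⟨D, hD, hl'⟩ := hP.lip
    refine ⟨C * D, mul_nonneg hC hD, fun Φ t ht hΦ => ?_⟩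
    rw [mul_assoc]
    exact hl (P Φ) (D * t) (mul_nonneg hD ht) (hl' Φ t ht hΦ)

end IsReadingFn

namespace IsLocalOp

variable {P Q : (X → V) → (X → V)} {S S' S'' T T' : Set X}

/-- the identity post-map. [cite: Balaban1985BackgroundPropagators, (3.42) p.397 (the entry G itself), bookkeeping] -/
theorem id (S : Set X) : IsLocalOp (fun Φ : X → V => Φ) S S :=
  ⟨fun _ _ => rfl, fun _ => rfl, ⟨1, zero_le_one, fun Φ t _ hΦ x hx => by simpa using hΦ x hx⟩⟩

/-- composition of local post-maps (read sets compose). [cite: Balaban1985BackgroundPropagators, (3.23) p.395 (Δ_U = Σ∇*∇), bookkeeping] -/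
theorem comp (hP : IsLocalOp P S S') (hQ : IsLocalOp Q S' S'') : IsLocalOp (fun Φ => P (Q Φ)) S S'' where
  add Φ Ψ := by simp only [hQ.add, hP.add]
  neg Φ := by simp only [hQ.neg, hP.neg]
  lip := by
    obtain ⟨C, hC, hl⟩ := hP.lip
    obtain ⟨D, hD, hl'⟩ := hQ.lip
    refine ⟨C * D, mul_nonneg hC hD, fun Φ t ht hΦ x hx => ?_⟩
    rw [mul_assoc]
    exact hl (Q Φ) (D * t) (mul_nonneg hD ht) (hl' Φ t ht hΦ) x hx

/-- shrinking the output set ∕ enlarging the read set. [cite: Balaban1985BackgroundPropagators, (3.42) p.397, bookkeeping] -/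
theorem mono (h : IsLocalOp P S S') (hT : T ⊆ S) (hT' : S' ⊆ T') : IsLocalOp P T T' := by
  obtain ⟨C, hC, hl⟩ := h.lip
  exact ⟨h.add, h.neg, ⟨C, hC, fun Φ t ht hΦ x hx => hl Φ t ht (fun x' hx' => hΦ x' (hT' hx')) x (hT hx)⟩⟩

/-- a finite sum of local post-maps is one. [cite: Balaban1985BackgroundPropagators, (3.23) p.395 (Σ_μ), bookkeeping] -/
theorem sum {ι : Type} (s : Finset ι) {Pa : ι → (X → V) → (X → V)} (h : ∀ a ∈ s, IsLocalOp (Pa a) S S') :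
    IsLocalOp (fun Φ => ∑ a ∈ s, Pa a Φ) S S' where
  add Φ Ψ := by
    rw [← Finset.sum_add_distrib]
    exact Finset.sum_congr rfl fun a ha => (h a ha).add Φ Ψ
  neg Φ := by
    rw [← Finset.sum_neg_distrib]
    exact Finset.sum_congr rfl fun a ha => (h a ha).neg Φ
  lip := by
    classical
    choose C hC hl using fun a : s => (h a.1 a.2).lip
    refine ⟨∑ a : s, C a, Finset.sum_nonneg fun a _ => hC a, fun Φ t ht hΦ x hx => ?_⟩
    rw [Finset.sum_apply, Finset.sum_mul, ← Finset.sum_coe_sort s]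
    exact (norm_sum_le _ _).trans (Finset.sum_le_sum fun a _ => hl a Φ t ht hΦ x hx)

end IsLocalOp

/-- **THE OUTER SUPREMUM OVER DIRECTIONS**: if, for every direction e, the bound b of the partial sums of the terms' e-readings passes to the
e-reading of the limit, and each term's reading is bounded over e, then the bound of the partial sums of the terms' sup-readings passes to the
sup-reading of the limit. [cite: Balaban1985BackgroundPropagators, (3.39) p.397 (𝔤-valued λ) + Thm 3.10 proof p.416, bookkeeping] -/
theorem iSup_le_of_partialSums {E Wk : Type} (W : ℕ → Finset Wk) (G : Wk → E → ℝ) (GO : E → ℝ) {b : ℝ} (hb : 0 ≤ b)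
    (hbdd : ∀ ω, BddAbove (Set.range (G ω)))
    (hpt : ∀ e, (∀ m, ∑ k ∈ Finset.range m, ∑ ω ∈ W k, G ω e ≤ b) → GO e ≤ b)
    (hsum : ∀ m, ∑ k ∈ Finset.range m, ∑ ω ∈ W k, (⨆ e, G ω e) ≤ b) : (⨆ e, GO e) ≤ b :=
  Real.iSup_le (fun e => hpt e fun m =>
    (Finset.sum_le_sum fun _ _ => Finset.sum_le_sum fun ω _ => le_ciSup (hbdd ω) e).trans (hsum m)) hb

/-- a family bounded by a constant has bounded range. [cite: Balaban1985BackgroundPropagators, (3.39) p.397, bookkeeping] -/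
theorem bddAbove_range_of_le {E : Type} {G : E → ℝ} (C : ℝ) (h : ∀ e, G e ≤ C) : BddAbove (Set.range G) :=
  ⟨C, by rintro _ ⟨e, rfl⟩; exact h e⟩

end Abstract

/-! ## §2 Pointwise convergence on a finite read set (edition v1.1) -/

section Tendsto

variable {X V : Type} [SeminormedAddCommGroup V]

/-- **POINTWISE CONVERGENCE ON A FINITE READ SET KEEPS THE BOUND**: the `Filter.Tendsto` form of `IsReadingFn.le_of_approx` — if the partial
sums `P m` obey `F (P m) ≤ b` and converge to `Φ` at every point of the FINITE read set `S`, then `F Φ ≤ b` (the form in which a norm-convergent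
operator series on a finite lattice is usually stated). [cite: Balaban1985BackgroundPropagators, Thm 3.10 proof p.416 («convergent in all norms»)] -/
theorem IsReadingFn.le_of_tendsto {F : (X → V) → ℝ} {S : Set X} (h : IsReadingFn F S) (hS : S.Finite) {Φ : X → V}
    {P : ℕ → X → V} {b : ℝ} (hP : ∀ m, F (P m) ≤ b)
    (hlim : ∀ x ∈ S, Filter.Tendsto (fun m => P m x) Filter.atTop (nhds (Φ x))) : F Φ ≤ b := by
  refine h.le_of_approx hP fun ε hε => ?_
  have hev : ∀ᶠ m in Filter.atTop, ∀ x ∈ S, dist (P m x) (Φ x) < ε :=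
    hS.eventually_all.2 fun x hx => (hlim x hx) (Metric.ball_mem_nhds (Φ x) hε)
  obtain ⟨m, hm⟩ := hev.exists
  exact ⟨m, fun x hx => by
    rw [← dist_eq_norm, dist_comm]
    exact (hm x hx).le⟩

end Tendsto

end Literature.MathematicalPhysics.QuantumFieldTheory.Balaban1983to89.B9Thm314WholeReadingCalculus

end
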